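import Summits.QuantumFields.YangMills.Theorems.UnitScaleTiltProp7CornerCombCoupledClosure
import HarnessLib

/-!
# Route `UnitScaleTilt`, crux K1 «MinimiserStabilityRegPr» (stmt-QuantumFields-19200), route-R E′ (A′)-on-Σ, P-A2 (β), row «(n3)-comb» —
# (O2) GROUNDWORK, file F-7c-3: THE λ-CLOSURE OF THE GAUGE LINE AND THE TWO-SLOT OUTPUT OF THE COUPLED COMB TOWER

«(O2) groundwork — not consumed by any displayed row before the freeze lifts» (★★OWNER `ym3-torus-plan` g29∕g30 RULINGS №20 (2), №22 (c) «(II) GO»).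
Cell `ym3-torus`, width seat `ym-ust-19200-w5` (gen 8); pens F-7c (★routeR-w1 g9 PENS ROUND 4, 2026-08-29) and F-8b (PENS ROUND 5).  THEOREMS ONLY (0 `def`, 0 `sorry`);
`--supports stmt-QuantumFields-19200 --as helper`, count-neutral.  Pure real analysis.  YM₃ on T³ is a ladder rung (R3), not the Clay problem; nothing here claims `hMcomb`,
(β), `hPA2`, the stub, the crux, d = 4 or the mass gap.
THE POINT.  Per level `j ≤ k₀` the comb tower carries the sourceless reduced mass `m_j ≤ M·ρ^j` and gradient `g_j ≤ Ĝ·(ρ⁻¹)^j` (✓F-7c-1), the sourced remainder `n_j`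
(✓F-7c-2 `n_closure`) and the covariant gradient `λ_j` of the accumulated gauge function (★routeR-w6 F-6d-3), which F-6d-3 bounds by a weighted sum over the LOWER levels of the
gradient∕mass∕step-defect cell energies of the FULL reduced family `G̃ = G̃^{lin} + N` — weights growing like `(√L)^{j−i} = (ρ⁻¹)^{j−i}`, MASS-weights carrying decaying windows,
and the SOURCED step defect containing `σ_i·ỹ_i`, `ỹ_i ≤ m_i + n_i + λ_i`: the lower `λ_i` feed back.  §1: the three level sums against the kernel `(ρ⁻¹)^{j−i}`.  §2 ★★★
`lam_closure`: from the scalar row `λ_j² ≤ Σ_{i<j}(ρ⁻¹)^{j−i}·(wG·g_i² + wN·n_i² + wM_i(m_i² + n_i²) + wS·σ_i²(m_i + n_i + λ_i)²)`, `wM_i ≤ ΘM·ρ^{4(k₀−i)}`, `σ_i ≤ θ₂ρ^{2(k₀−i)}`,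
ONE `Q`-free smallness `12wSθ₂²·ρ∕(1−ρ) ≤ ½`, by strong induction: `∀ Q ≥ 0, ∀ j ≤ k₀, (∀ i<j, n_i ≤ Q(ρ⁻¹)^i) → λ_j ≤ (cB0 + cB1·Q)(ρ⁻¹)^j + cA·ρ^j` — VERBATIM the
hypothesis `hfb` of ✓`n_closure` — for any constants whose squares dominate three closed expressions.  §3 ★★★ `n_lam_closure` = `n_closure ∘ lam_closure` and ★★★
`n_lam_two_slot`: `n_j ≤ aN·ρ^j + bN·(ρ⁻¹)^j`, `λ_j ≤ (cA + cB1·aN)ρ^j + (cB0 + cB1·bN)(ρ⁻¹)^j`, `aN = 2eθ₂(M + cA)ρ∕(1−ρ²)`, `bN = 2eθ₂cB0ρ³∕(1−ρ⁴)` — the mass datum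
only in the A-slot (times windows), the gradient datum `cB0 ∝ Ĝ` in the B-slot: with `(ρ^l)² = L^{−l}`, `((ρ⁻¹)^l)² = Lˡ`, `sq_le_two_slot` the shape `A′·MASS₀·L^{−l} + B′·GRAD₀·Lˡ`
of F-8b's cell theorem.  HONEST SCOPE: bookkeeping; every window∕smallness is a hypothesis (discharged from `RegPr` in F-8c-3); the `ρ = (√L)⁻¹` dictionary is F-8b's.
References: T. Bałaban, CMP **109** (1987) 249–301 [Balaban1987RG1] ((0.1), (0.4) pp.251–253: the inductive level bounds); CMP **98** (1985) 17–51 [Balaban1985Averaging]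
(Prop. 3 (122)–(126), Prop. 7); CMP **95** (1984) 17–40 [Balaban1984PropagatorsI] ((1.18)–(1.20)).
-/
noncomputable section

open scoped BigOperators
open Finset

namespace Summit.QuantumFields.YangMills.Theorems.Prop7CornerCombLambdaClosure

open Summit.QuantumFields.YangMills.Theorems.Prop7CornerCombCoupledClosure (n_closure)

/-! ## §1 The three level sums against the kernel `(ρ⁻¹)^{j−i}` -/

/-- `Σ_{t<j} r^t ≤ 1∕(1−r)` for `0 ≤ r < 1`. [folklore] -/
theorem geom_sum_le_inv_one_sub {r : ℝ} (hr0 : 0 ≤ r) (hr1 : r < 1) (j : ℕ) : ∑ t ∈ Finset.range j, r ^ t ≤ 1 / (1 - r) := by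
  have h1 : 0 < 1 - r := by linarith
  rw [le_div_iff₀ h1, geom_sum_mul_neg r j]
  have : 0 ≤ r ^ j := pow_nonneg hr0 j
  linarith

/-- `ρ⁵∕(1−ρ⁵) ≤ ρ∕(1−ρ)` for `0 ≤ ρ < 1`. [folklore] -/
theorem pow_five_div_le {ρ : ℝ} (hρ0 : 0 ≤ ρ) (hρ1 : ρ < 1) : ρ ^ 5 / (1 - ρ ^ 5) ≤ ρ / (1 - ρ) := by
  have h5 : ρ ^ 5 ≤ ρ := (pow_le_pow_of_le_one hρ0 hρ1.le (by norm_num : 1 ≤ 5)).trans (pow_one ρ).le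
  exact div_le_div₀ hρ0 h5 (by linarith) (by linarith)

/-- B-fed term: `(ρ⁻¹)^{j−i}·((ρ⁻¹)^i)² = ((ρ⁻¹)^j)²·(ρ·ρ^{j−1−i})` (`i < j`, `ρ ≠ 0`). [folklore] -/
theorem kernel_B_term_eq {ρ : ℝ} (hρ : ρ ≠ 0) {i j : ℕ} (hij : i < j) :
    (ρ⁻¹) ^ (j - i) * ((ρ⁻¹) ^ i) ^ 2 = ((ρ⁻¹) ^ j) ^ 2 * (ρ * ρ ^ (j - 1 - i)) := by
  obtain ⟨t, rfl⟩ := Nat.exists_eq_add_of_lt hij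
  rw [show i + t + 1 - i = t + 1 by omega, show i + t + 1 - 1 - i = t by omega]
  simp only [inv_pow]
  field_simp
  ring

/-- Window-fed A term: `(ρ⁻¹)^{j−i}·ρ^{4(k₀−i)}·(ρ^i)² = (ρ^j)²·(ρ^{4(k₀−j)}·ρ·ρ^{j−1−i})` (`i < j ≤ k₀`, `ρ ≠ 0`). [folklore] -/
theorem kernel_winA_term_eq {ρ : ℝ} (hρ : ρ ≠ 0) {i j k₀ : ℕ} (hij : i < j) (hjk : j ≤ k₀) :
    (ρ⁻¹) ^ (j - i) * ρ ^ (4 * (k₀ - i)) * (ρ ^ i) ^ 2 = (ρ ^ j) ^ 2 * (ρ ^ (4 * (k₀ - j)) * ρ * ρ ^ (j - 1 - i)) := by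
  obtain ⟨t, rfl⟩ := Nat.exists_eq_add_of_lt hij
  obtain ⟨s, rfl⟩ := Nat.exists_eq_add_of_le hjk
  rw [show i + t + 1 - i = t + 1 by omega, show i + t + 1 - 1 - i = t by omega, show 4 * (i + t + 1 + s - i) = 4 * (t + 1 + s) by omega,
    show i + t + 1 + s - (i + t + 1) = s by omega]
  simp only [inv_pow]
  field_simp
  ring

/-- Window-fed B term: `(ρ⁻¹)^{j−i}·ρ^{4(k₀−i)}·((ρ⁻¹)^i)² = ((ρ⁻¹)^j)²·(ρ^{4(k₀−j)}·ρ⁵·(ρ⁵)^{j−1−i})` (`i < j ≤ k₀`, `ρ ≠ 0`). [folklore] -/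
theorem kernel_winB_term_eq {ρ : ℝ} (hρ : ρ ≠ 0) {i j k₀ : ℕ} (hij : i < j) (hjk : j ≤ k₀) :
    (ρ⁻¹) ^ (j - i) * ρ ^ (4 * (k₀ - i)) * ((ρ⁻¹) ^ i) ^ 2 = ((ρ⁻¹) ^ j) ^ 2 * (ρ ^ (4 * (k₀ - j)) * ρ ^ 5 * (ρ ^ 5) ^ (j - 1 - i)) := by
  obtain ⟨t, rfl⟩ := Nat.exists_eq_add_of_lt hij
  obtain ⟨s, rfl⟩ := Nat.exists_eq_add_of_le hjk
  rw [show i + t + 1 - i = t + 1 by omega, show i + t + 1 - 1 - i = t by omega, show 4 * (i + t + 1 + s - i) = 4 * (t + 1 + s) by omega,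
    show i + t + 1 + s - (i + t + 1) = s by omega]
  simp only [inv_pow]
  field_simp
  ring

/-- ★ `Σ_{i<j} (ρ⁻¹)^{j−i}·((ρ⁻¹)^i)² ≤ ((ρ⁻¹)^j)²·(ρ∕(1−ρ))` (`0 < ρ < 1`): B-shaped data fed along the `(ρ⁻¹)^{j−i}` kernel stay B-shaped, gaining `ρ`. [folklore] -/
theorem sum_kernel_B_le {ρ : ℝ} (hρ0 : 0 < ρ) (hρ1 : ρ < 1) (j : ℕ) :
    ∑ i ∈ Finset.range j, (ρ⁻¹) ^ (j - i) * ((ρ⁻¹) ^ i) ^ 2 ≤ ((ρ⁻¹) ^ j) ^ 2 * (ρ / (1 - ρ)) := by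
  rw [Finset.sum_congr rfl fun i hi => kernel_B_term_eq hρ0.ne' (Finset.mem_range.mp hi), ← Finset.mul_sum, ← Finset.mul_sum,
    Finset.sum_range_reflect (fun t => ρ ^ t) j]
  have hgeom := geom_sum_le_inv_one_sub hρ0.le hρ1 j
  have h0 : 0 ≤ ((ρ⁻¹) ^ j) ^ 2 * ρ := by positivity
  calc ((ρ⁻¹) ^ j) ^ 2 * (ρ * ∑ t ∈ Finset.range j, ρ ^ t) = (((ρ⁻¹) ^ j) ^ 2 * ρ) * ∑ t ∈ Finset.range j, ρ ^ t := by ring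
    _ ≤ (((ρ⁻¹) ^ j) ^ 2 * ρ) * (1 / (1 - ρ)) := mul_le_mul_of_nonneg_left hgeom h0
    _ = _ := by ring

/-- ★ `Σ_{i<j} (ρ⁻¹)^{j−i}·ρ^{4(k₀−i)}·(ρ^i)² ≤ (ρ^j)²·(ρ∕(1−ρ))` (`0 < ρ < 1`, `j ≤ k₀`): A-shaped data with a decaying window stay A-shaped (`ρ^{4(k₀−j)} ≤ 1` spent). [folklore] -/
theorem sum_kernel_winA_le {ρ : ℝ} (hρ0 : 0 < ρ) (hρ1 : ρ < 1) {j k₀ : ℕ} (hjk : j ≤ k₀) :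
    ∑ i ∈ Finset.range j, (ρ⁻¹) ^ (j - i) * ρ ^ (4 * (k₀ - i)) * (ρ ^ i) ^ 2 ≤ (ρ ^ j) ^ 2 * (ρ / (1 - ρ)) := by
  rw [Finset.sum_congr rfl fun i hi => kernel_winA_term_eq hρ0.ne' (Finset.mem_range.mp hi) hjk, ← Finset.mul_sum, ← Finset.mul_sum,
    Finset.sum_range_reflect (fun t => ρ ^ t) j]
  have hgeom := geom_sum_le_inv_one_sub hρ0.le hρ1 j
  have hw : ρ ^ (4 * (k₀ - j)) ≤ 1 := pow_le_one₀ hρ0.le hρ1.le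
  have hs0 : 0 ≤ ∑ t ∈ Finset.range j, ρ ^ t := Finset.sum_nonneg fun t _ => pow_nonneg hρ0.le t
  have h0 : 0 ≤ (ρ ^ j) ^ 2 := by positivity
  calc (ρ ^ j) ^ 2 * (ρ ^ (4 * (k₀ - j)) * ρ * ∑ t ∈ Finset.range j, ρ ^ t)
      = (ρ ^ j) ^ 2 * (ρ ^ (4 * (k₀ - j)) * (ρ * ∑ t ∈ Finset.range j, ρ ^ t)) := by ring
    _ ≤ (ρ ^ j) ^ 2 * (1 * (ρ * (1 / (1 - ρ)))) :=
        mul_le_mul_of_nonneg_left (mul_le_mul hw (mul_le_mul_of_nonneg_left hgeom hρ0.le) (by positivity) zero_le_one) h0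
    _ = _ := by ring

/-- ★ `Σ_{i<j} (ρ⁻¹)^{j−i}·ρ^{4(k₀−i)}·((ρ⁻¹)^i)² ≤ ((ρ⁻¹)^j)²·(ρ⁵∕(1−ρ⁵))` (`0 < ρ < 1`, `j ≤ k₀`): B-shaped data with a decaying window stay B-shaped, gaining `ρ⁵`. [folklore] -/
theorem sum_kernel_winB_le {ρ : ℝ} (hρ0 : 0 < ρ) (hρ1 : ρ < 1) {j k₀ : ℕ} (hjk : j ≤ k₀) :
    ∑ i ∈ Finset.range j, (ρ⁻¹) ^ (j - i) * ρ ^ (4 * (k₀ - i)) * ((ρ⁻¹) ^ i) ^ 2 ≤ ((ρ⁻¹) ^ j) ^ 2 * (ρ ^ 5 / (1 - ρ ^ 5)) := by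
  have hρ5 : ρ ^ 5 < 1 := pow_lt_one₀ hρ0.le hρ1 (by norm_num)
  rw [Finset.sum_congr rfl fun i hi => kernel_winB_term_eq hρ0.ne' (Finset.mem_range.mp hi) hjk, ← Finset.mul_sum, ← Finset.mul_sum,
    Finset.sum_range_reflect (fun t => (ρ ^ 5) ^ t) j]
  have hgeom := geom_sum_le_inv_one_sub (pow_nonneg hρ0.le 5) hρ5 j
  have hw : ρ ^ (4 * (k₀ - j)) ≤ 1 := pow_le_one₀ hρ0.le hρ1.le
  have h0 : 0 ≤ ((ρ⁻¹) ^ j) ^ 2 := by positivity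
  calc ((ρ⁻¹) ^ j) ^ 2 * (ρ ^ (4 * (k₀ - j)) * ρ ^ 5 * ∑ t ∈ Finset.range j, (ρ ^ 5) ^ t)
      = ((ρ⁻¹) ^ j) ^ 2 * (ρ ^ (4 * (k₀ - j)) * (ρ ^ 5 * ∑ t ∈ Finset.range j, (ρ ^ 5) ^ t)) := by ring
    _ ≤ ((ρ⁻¹) ^ j) ^ 2 * (1 * (ρ ^ 5 * (1 / (1 - ρ ^ 5)))) :=
        mul_le_mul_of_nonneg_left (mul_le_mul hw (mul_le_mul_of_nonneg_left hgeom (pow_nonneg hρ0.le 5)) (by positivity) zero_le_one) h0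
    _ = _ := by ring

/-! ## §2 ★★★ The λ-closure (the gauge line's feedback resolved by strong induction) -/

/-- From `x ≤ C·u` with `0 ≤ x` (and `0 ≤ C`, `0 ≤ u`): `x² ≤ C²·u²`. [folklore] -/
theorem sq_le_sq_mul {x C u : ℝ} (hx : 0 ≤ x) (h : x ≤ C * u) : x ^ 2 ≤ C ^ 2 * u ^ 2 := by
  rw [← mul_pow]; exact pow_le_pow_left₀ hx h 2

/-- From `0 ≤ y ≤ a·u + b·v`: `y² ≤ 2a²u² + 2b²v²`. [folklore] -/
theorem sq_le_two_slot {y a b u v : ℝ} (hy : 0 ≤ y) (h : y ≤ a * u + b * v) : y ^ 2 ≤ 2 * (a ^ 2 * u ^ 2) + 2 * (b ^ 2 * v ^ 2) := by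
  have h1 : y ^ 2 ≤ (a * u + b * v) ^ 2 := pow_le_pow_left₀ hy h 2
  nlinarith [sq_nonneg (a * u - b * v)]

/-- ONE SUMMAND of the λ-row under the inductive data: with `g_i ≤ Ĝ(ρ⁻¹)^i`, `n_i ≤ Q(ρ⁻¹)^i`, `m_i ≤ Mρ^i`, `λ_i ≤ (cB0 + cB1·Q)(ρ⁻¹)^i + cA·ρ^i`, `wM_i ≤ ΘM·ρ^{4(k₀−i)}`,
`σ_i ≤ θ₂ρ^{2(k₀−i)}` (all letters nonnegative):
`wG·g_i² + wN·n_i² + wM_i(m_i² + n_i²) + wS·σ_i²(m_i + n_i + λ_i)² ≤ (wG·Ĝ² + wN·Q²)·((ρ⁻¹)^i)² + ρ^{4(k₀−i)}·(c₂·(ρ^i)² + c₃·((ρ⁻¹)^i)²)` with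
`c₂ = (ΘM + 3wSθ₂²)M² + 6wSθ₂²cA²`, `c₃ = (ΘM + 3wSθ₂²)Q² + 6wSθ₂²(cB0 + cB1·Q)²`. [bookkeeping] -/
theorem row_summand_le {ρ θ₂ ΘM wG wN wS Ĝ M Q cA cB0 cB1 gi ni mi li wMi σi : ℝ} (hρ0 : 0 < ρ) (hwG : 0 ≤ wG) (hwN : 0 ≤ wN) (hwS : 0 ≤ wS)
    (hgi : 0 ≤ gi) (hni : 0 ≤ ni) (hmi : 0 ≤ mi) (hli : 0 ≤ li) (hwMi : 0 ≤ wMi) (hσi : 0 ≤ σi) {i k₀ : ℕ}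
    (hg : gi ≤ Ĝ * (ρ⁻¹) ^ i) (hn : ni ≤ Q * (ρ⁻¹) ^ i) (hm : mi ≤ M * ρ ^ i) (hl : li ≤ (cB0 + cB1 * Q) * (ρ⁻¹) ^ i + cA * ρ ^ i)
    (hwM : wMi ≤ ΘM * ρ ^ (4 * (k₀ - i))) (hσ : σi ≤ θ₂ * ρ ^ (2 * (k₀ - i))) :
    wG * gi ^ 2 + wN * ni ^ 2 + wMi * (mi ^ 2 + ni ^ 2) + wS * σi ^ 2 * (mi + ni + li) ^ 2
      ≤ (wG * Ĝ ^ 2 + wN * Q ^ 2) * ((ρ⁻¹) ^ i) ^ 2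
        + ρ ^ (4 * (k₀ - i)) * (((ΘM + 3 * wS * θ₂ ^ 2) * M ^ 2 + 6 * wS * θ₂ ^ 2 * cA ^ 2) * (ρ ^ i) ^ 2
            + ((ΘM + 3 * wS * θ₂ ^ 2) * Q ^ 2 + 6 * wS * θ₂ ^ 2 * (cB0 + cB1 * Q) ^ 2) * ((ρ⁻¹) ^ i) ^ 2) := by
  set X : ℝ := ((ρ⁻¹) ^ i) ^ 2 with hX
  set A : ℝ := (ρ ^ i) ^ 2 with hA
  set W : ℝ := ρ ^ (4 * (k₀ - i)) with hW
  have hX0 : 0 ≤ X := by positivity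
  have hA0 : 0 ≤ A := by positivity
  have hW0 : 0 ≤ W := by positivity
  have hg2 : gi ^ 2 ≤ Ĝ ^ 2 * X := sq_le_sq_mul hgi hg
  have hn2 : ni ^ 2 ≤ Q ^ 2 * X := sq_le_sq_mul hni hn
  have hm2 : mi ^ 2 ≤ M ^ 2 * A := sq_le_sq_mul hmi hm
  have hl2 : li ^ 2 ≤ 2 * ((cB0 + cB1 * Q) ^ 2 * X) + 2 * (cA ^ 2 * A) := sq_le_two_slot hli hl
  have hσ2 : σi ^ 2 ≤ θ₂ ^ 2 * W := by
    have := sq_le_sq_mul hσi hσ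
    rw [← pow_mul, show 2 * (k₀ - i) * 2 = 4 * (k₀ - i) by ring] at this
    exact this
  have hy2 : (mi + ni + li) ^ 2 ≤ 3 * (M ^ 2 * A + Q ^ 2 * X + (2 * ((cB0 + cB1 * Q) ^ 2 * X) + 2 * (cA ^ 2 * A))) := by
    have : (mi + ni + li) ^ 2 ≤ 3 * (mi ^ 2 + ni ^ 2 + li ^ 2) := by
      nlinarith [sq_nonneg (mi - ni), sq_nonneg (ni - li), sq_nonneg (mi - li)]
    linarith
  have hy0 : 0 ≤ (mi + ni + li) ^ 2 := sq_nonneg _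
  have p1 : wG * gi ^ 2 ≤ wG * (Ĝ ^ 2 * X) := mul_le_mul_of_nonneg_left hg2 hwG
  have p2 : wN * ni ^ 2 ≤ wN * (Q ^ 2 * X) := mul_le_mul_of_nonneg_left hn2 hwN
  have p3 : wMi * (mi ^ 2 + ni ^ 2) ≤ (ΘM * W) * (M ^ 2 * A + Q ^ 2 * X) :=
    mul_le_mul hwM (add_le_add hm2 hn2) (by positivity) (hwMi.trans hwM)
  have p4 : wS * σi ^ 2 * (mi + ni + li) ^ 2
      ≤ wS * (θ₂ ^ 2 * W) * (3 * (M ^ 2 * A + Q ^ 2 * X + (2 * ((cB0 + cB1 * Q) ^ 2 * X) + 2 * (cA ^ 2 * A)))) :=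
    mul_le_mul (mul_le_mul_of_nonneg_left hσ2 hwS) hy2 hy0 (by positivity)
  have hsum := add_le_add (add_le_add (add_le_add p1 p2) p3) p4
  refine hsum.trans (le_of_eq ?_)
  ring

/-- ★★★ **THE λ-CLOSURE.**  Reals `0 < ρ < 1`, letters `θ₂ Ĝ M` and nonnegative `ΘM wG wN wS cA cB0 cB1`; nonnegative sequences `σ n m g lam wM`; top level `k₀`.  HYPOTHESES: the windows
`σ_i ≤ θ₂·ρ^{2(k₀−i)}`, `wM_i ≤ ΘM·ρ^{4(k₀−i)}` (`i < k₀`); the sourceless lines `m_j ≤ M·ρ^j`, `g_j ≤ Ĝ·(ρ⁻¹)^j` (`j ≤ k₀`, ✓F-7c-1); THE GAUGE ROW (F-6d-3 in scalar letters,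
after `GRAD(G̃) ≤ 2g² + 8d·n²`, `MASS(G̃) ≤ 2m² + 2n²`, `DEF ≤ cΔα²·MASS + 2σ²ỹ²` and the `ρ = (√L)⁻¹` dictionary):
`λ_j² ≤ Σ_{i<j} (ρ⁻¹)^{j−i}·(wG·g_i² + wN·n_i² + wM_i·(m_i² + n_i²) + wS·σ_i²·(m_i + n_i + λ_i)²)` (`j ≤ k₀`); the `Q`-FREE smallness `12·wS·θ₂²·(ρ∕(1−ρ)) ≤ ½`; and
constants with `2wG·Ĝ²·ρ∕(1−ρ) ≤ cB0²`, `2(wN·ρ∕(1−ρ) + (ΘM + 3wSθ₂²)·ρ⁵∕(1−ρ⁵)) ≤ cB1²`, `2(ΘM + 3wSθ₂²)·M²·ρ∕(1−ρ) ≤ cA²`.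
CONCLUSION (VERBATIM the hypothesis `hfb` of ✓`Prop7CornerCombCoupledClosure.n_closure`): for every `Q ≥ 0` and `j ≤ k₀`,
`(∀ i < j, n_i ≤ Q·(ρ⁻¹)^i) → λ_j ≤ (cB0 + cB1·Q)·(ρ⁻¹)^j + cA·ρ^j`.
PROOF: strong induction on `j`; each summand by `row_summand_le`, the three sums by §1, absorption of the `λ`-feedback by the smallness (`6wSθ₂²·ρ⁵∕(1−ρ⁵) ≤ 6wSθ₂²·ρ∕(1−ρ) ≤ ¼`).
[Balaban1987RG1 (0.4) p.253 — the inductive hypothesis on the gauge-field gradients, scalar form] -/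
theorem lam_closure {ρ θ₂ ΘM wG wN wS Ĝ M cA cB0 cB1 : ℝ} (hρ0 : 0 < ρ) (hρ1 : ρ < 1) (hΘM : 0 ≤ ΘM) (hwG : 0 ≤ wG) (hwN : 0 ≤ wN)
    (hwS : 0 ≤ wS) (hcA : 0 ≤ cA) (hcB0 : 0 ≤ cB0) (hcB1 : 0 ≤ cB1) (σ n m g lam wM : ℕ → ℝ) (hσ : ∀ j, 0 ≤ σ j) (hn : ∀ j, 0 ≤ n j) (hm0 : ∀ j, 0 ≤ m j) (hg0 : ∀ j, 0 ≤ g j) (hlam : ∀ j, 0 ≤ lam j)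
    (hwM0 : ∀ j, 0 ≤ wM j) {k₀ : ℕ}
    (hσgeo : ∀ j < k₀, σ j ≤ θ₂ * ρ ^ (2 * (k₀ - j))) (hwMgeo : ∀ j < k₀, wM j ≤ ΘM * ρ ^ (4 * (k₀ - j)))
    (hm : ∀ j ≤ k₀, m j ≤ M * ρ ^ j) (hg : ∀ j ≤ k₀, g j ≤ Ĝ * (ρ⁻¹) ^ j)
    (hrow : ∀ j ≤ k₀, lam j ^ 2 ≤ ∑ i ∈ Finset.range j,
      (ρ⁻¹) ^ (j - i) * (wG * g i ^ 2 + wN * n i ^ 2 + wM i * (m i ^ 2 + n i ^ 2) + wS * σ i ^ 2 * (m i + n i + lam i) ^ 2))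
    (hsmallS : 12 * wS * θ₂ ^ 2 * (ρ / (1 - ρ)) ≤ 1 / 2)
    (hcB0sq : 2 * wG * Ĝ ^ 2 * (ρ / (1 - ρ)) ≤ cB0 ^ 2)
    (hcB1sq : 2 * (wN * (ρ / (1 - ρ)) + (ΘM + 3 * wS * θ₂ ^ 2) * (ρ ^ 5 / (1 - ρ ^ 5))) ≤ cB1 ^ 2)
    (hcAsq : 2 * ((ΘM + 3 * wS * θ₂ ^ 2) * M ^ 2) * (ρ / (1 - ρ)) ≤ cA ^ 2) :
    ∀ Q : ℝ, 0 ≤ Q → ∀ j ≤ k₀, (∀ i < j, n i ≤ Q * (ρ⁻¹) ^ i) → lam j ≤ (cB0 + cB1 * Q) * (ρ⁻¹) ^ j + cA * ρ ^ j := by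
  intro Q hQ j
  induction j using Nat.strong_induction_on with
  | _ j ih =>
    intro hj hQn
    set R : ℕ → ℝ := fun i => (cB0 + cB1 * Q) * (ρ⁻¹) ^ i + cA * ρ ^ i with hR
    have hR0 : ∀ i, 0 ≤ R i := fun i => by
      show 0 ≤ (cB0 + cB1 * Q) * (ρ⁻¹) ^ i + cA * ρ ^ i
      positivity
    have hih : ∀ i < j, lam i ≤ (cB0 + cB1 * Q) * (ρ⁻¹) ^ i + cA * ρ ^ i :=
      fun i hi => ih i hi (by omega) fun i' hi' => hQn i' (lt_trans hi' hi)
    have hB := Summit.QuantumFields.YangMills.Theorems.Prop7CornerCombLambdaClosure.sum_kernel_B_le hρ0 hρ1 j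
    have hWA := sum_kernel_winA_le hρ0 hρ1 hj
    have hWB := sum_kernel_winB_le hρ0 hρ1 hj
    set c₁ : ℝ := wG * Ĝ ^ 2 + wN * Q ^ 2 with hc₁
    set c₂ : ℝ := (ΘM + 3 * wS * θ₂ ^ 2) * M ^ 2 + 6 * wS * θ₂ ^ 2 * cA ^ 2 with hc₂
    set c₃ : ℝ := (ΘM + 3 * wS * θ₂ ^ 2) * Q ^ 2 + 6 * wS * θ₂ ^ 2 * (cB0 + cB1 * Q) ^ 2 with hc₃
    have hc₁0 : 0 ≤ c₁ := by positivity
    have hc₂0 : 0 ≤ c₂ := by positivity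
    have hc₃0 : 0 ≤ c₃ := by positivity
    have hterm : ∀ i ∈ Finset.range j,
        (ρ⁻¹) ^ (j - i) * (wG * g i ^ 2 + wN * n i ^ 2 + wM i * (m i ^ 2 + n i ^ 2) + wS * σ i ^ 2 * (m i + n i + lam i) ^ 2)
          ≤ c₁ * ((ρ⁻¹) ^ (j - i) * ((ρ⁻¹) ^ i) ^ 2) + c₂ * ((ρ⁻¹) ^ (j - i) * ρ ^ (4 * (k₀ - i)) * (ρ ^ i) ^ 2)
            + c₃ * ((ρ⁻¹) ^ (j - i) * ρ ^ (4 * (k₀ - i)) * ((ρ⁻¹) ^ i) ^ 2) := by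
      intro i hi
      have hij := Finset.mem_range.mp hi
      have hs := row_summand_le hρ0 hwG hwN hwS (hg0 i) (hn i) (hm0 i) (hlam i) (hwM0 i) (hσ i)
        (hg i (by omega)) (hQn i hij) (hm i (by omega)) (hih i hij) (hwMgeo i (by omega)) (hσgeo i (by omega))
      have hk0 : 0 ≤ (ρ⁻¹) ^ (j - i) := by positivity
      calc (ρ⁻¹) ^ (j - i) * (wG * g i ^ 2 + wN * n i ^ 2 + wM i * (m i ^ 2 + n i ^ 2) + wS * σ i ^ 2 * (m i + n i + lam i) ^ 2)
          ≤ (ρ⁻¹) ^ (j - i) * ((wG * Ĝ ^ 2 + wN * Q ^ 2) * ((ρ⁻¹) ^ i) ^ 2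
              + ρ ^ (4 * (k₀ - i)) * (((ΘM + 3 * wS * θ₂ ^ 2) * M ^ 2 + 6 * wS * θ₂ ^ 2 * cA ^ 2) * (ρ ^ i) ^ 2
                + ((ΘM + 3 * wS * θ₂ ^ 2) * Q ^ 2 + 6 * wS * θ₂ ^ 2 * (cB0 + cB1 * Q) ^ 2) * ((ρ⁻¹) ^ i) ^ 2)) :=
            mul_le_mul_of_nonneg_left hs hk0
        _ = _ := by simp only [hc₁, hc₂, hc₃]; ring
    have hsum : lam j ^ 2 ≤ c₁ * (((ρ⁻¹) ^ j) ^ 2 * (ρ / (1 - ρ))) + c₂ * ((ρ ^ j) ^ 2 * (ρ / (1 - ρ)))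
        + c₃ * (((ρ⁻¹) ^ j) ^ 2 * (ρ ^ 5 / (1 - ρ ^ 5))) := by
      calc lam j ^ 2 ≤ _ := hrow j hj
        _ ≤ ∑ i ∈ Finset.range j, (c₁ * ((ρ⁻¹) ^ (j - i) * ((ρ⁻¹) ^ i) ^ 2) + c₂ * ((ρ⁻¹) ^ (j - i) * ρ ^ (4 * (k₀ - i)) * (ρ ^ i) ^ 2)
            + c₃ * ((ρ⁻¹) ^ (j - i) * ρ ^ (4 * (k₀ - i)) * ((ρ⁻¹) ^ i) ^ 2)) := Finset.sum_le_sum hterm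
        _ = c₁ * ∑ i ∈ Finset.range j, (ρ⁻¹) ^ (j - i) * ((ρ⁻¹) ^ i) ^ 2
            + c₂ * ∑ i ∈ Finset.range j, (ρ⁻¹) ^ (j - i) * ρ ^ (4 * (k₀ - i)) * (ρ ^ i) ^ 2
            + c₃ * ∑ i ∈ Finset.range j, (ρ⁻¹) ^ (j - i) * ρ ^ (4 * (k₀ - i)) * ((ρ⁻¹) ^ i) ^ 2 := by
          rw [Finset.sum_add_distrib, Finset.sum_add_distrib, ← Finset.mul_sum, ← Finset.mul_sum, ← Finset.mul_sum]
        _ ≤ _ := add_le_add (add_le_add (mul_le_mul_of_nonneg_left hB hc₁0) (mul_le_mul_of_nonneg_left hWA hc₂0))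
              (mul_le_mul_of_nonneg_left hWB hc₃0)
    have hr0 : 0 ≤ ρ / (1 - ρ) := div_nonneg hρ0.le (by linarith)
    have h51 : ρ ^ 5 / (1 - ρ ^ 5) ≤ ρ / (1 - ρ) := pow_five_div_le hρ0.le hρ1
    have h50 : 0 ≤ ρ ^ 5 / (1 - ρ ^ 5) := div_nonneg (pow_nonneg hρ0.le 5) (by
      have := pow_lt_one₀ hρ0.le hρ1 (by norm_num : (5 : ℕ) ≠ 0); linarith)
    set X : ℝ := ((ρ⁻¹) ^ j) ^ 2 with hX
    set A : ℝ := (ρ ^ j) ^ 2 with hA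
    have hX0 : 0 ≤ X := by positivity
    have hA0 : 0 ≤ A := by positivity
    have hwsθ : 0 ≤ wS * θ₂ ^ 2 := by positivity
    -- B part: c₁·r + c₃·r₅ ≤ (cB0 + cB1 Q)²
    set r : ℝ := ρ / (1 - ρ) with hr
    set r₅ : ℝ := ρ ^ 5 / (1 - ρ ^ 5) with hr₅
    set S : ℝ := cB0 + cB1 * Q with hS
    have hS2 : cB0 ^ 2 + cB1 ^ 2 * Q ^ 2 ≤ S ^ 2 := by
      have hx : 0 ≤ cB0 * cB1 * Q := by positivity
      have : S ^ 2 = cB0 ^ 2 + cB1 ^ 2 * Q ^ 2 + 2 * (cB0 * cB1 * Q) := by simp only [hS]; ring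
      linarith
    have hS0 : 0 ≤ S ^ 2 := sq_nonneg S
    have a3 : 6 * wS * θ₂ ^ 2 * r ≤ 1 / 4 := by linarith
    have a3' : 6 * wS * θ₂ ^ 2 * r₅ ≤ 1 / 4 := by
      have := mul_le_mul_of_nonneg_left h51 (by positivity : (0 : ℝ) ≤ 6 * wS * θ₂ ^ 2)
      linarith
    have hBpart : c₁ * r + c₃ * r₅ ≤ S ^ 2 := by
      have a1 : wG * Ĝ ^ 2 * r ≤ cB0 ^ 2 / 2 := by linarith
      have a2 : wN * Q ^ 2 * r + (ΘM + 3 * wS * θ₂ ^ 2) * Q ^ 2 * r₅ ≤ cB1 ^ 2 * Q ^ 2 / 2 := by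
        have h := mul_le_mul_of_nonneg_left hcB1sq (sq_nonneg Q)
        have e : Q ^ 2 * (2 * (wN * r + (ΘM + 3 * wS * θ₂ ^ 2) * r₅)) = 2 * (wN * Q ^ 2 * r + (ΘM + 3 * wS * θ₂ ^ 2) * Q ^ 2 * r₅) := by ring
        have e' : Q ^ 2 * cB1 ^ 2 = cB1 ^ 2 * Q ^ 2 := by ring
        linarith
      have a4 : 6 * wS * θ₂ ^ 2 * S ^ 2 * r₅ ≤ S ^ 2 / 4 := by
        have h := mul_le_mul_of_nonneg_left a3' hS0
        have e : S ^ 2 * (6 * wS * θ₂ ^ 2 * r₅) = 6 * wS * θ₂ ^ 2 * S ^ 2 * r₅ := by ring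
        linarith
      have e : c₁ * r + c₃ * r₅ = wG * Ĝ ^ 2 * r + (wN * Q ^ 2 * r + (ΘM + 3 * wS * θ₂ ^ 2) * Q ^ 2 * r₅) + 6 * wS * θ₂ ^ 2 * S ^ 2 * r₅ := by
        simp only [hc₁, hc₃]; ring
      linarith
    -- A part: c₂·r ≤ cA²
    have hApart : c₂ * r ≤ cA ^ 2 := by
      have b1 : (ΘM + 3 * wS * θ₂ ^ 2) * M ^ 2 * r ≤ cA ^ 2 / 2 := by
        have e : 2 * ((ΘM + 3 * wS * θ₂ ^ 2) * M ^ 2) * r = 2 * ((ΘM + 3 * wS * θ₂ ^ 2) * M ^ 2 * r) := by ring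
        linarith
      have b3 : 6 * wS * θ₂ ^ 2 * cA ^ 2 * r ≤ cA ^ 2 / 4 := by
        have h := mul_le_mul_of_nonneg_left a3 (sq_nonneg cA)
        have e : cA ^ 2 * (6 * wS * θ₂ ^ 2 * r) = 6 * wS * θ₂ ^ 2 * cA ^ 2 * r := by ring
        linarith
      have e : c₂ * r = (ΘM + 3 * wS * θ₂ ^ 2) * M ^ 2 * r + 6 * wS * θ₂ ^ 2 * cA ^ 2 * r := by simp only [hc₂]; ring
      linarith [sq_nonneg cA]
    have hfin : lam j ^ 2 ≤ (R j) ^ 2 := by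
      have hcross : 0 ≤ 2 * (S * (ρ⁻¹) ^ j) * (cA * ρ ^ j) := by positivity
      have hRsq : (R j) ^ 2 = S ^ 2 * X + cA ^ 2 * A + 2 * (S * (ρ⁻¹) ^ j) * (cA * ρ ^ j) := by
        simp only [hR, hS, hX, hA]; ring
      have h1 : c₁ * (X * r) + c₂ * (A * r) + c₃ * (X * r₅) = (c₁ * r + c₃ * r₅) * X + (c₂ * r) * A := by ring
      rw [hRsq]
      calc lam j ^ 2 ≤ _ := hsum
        _ = _ := h1
        _ ≤ S ^ 2 * X + cA ^ 2 * A := add_le_add (mul_le_mul_of_nonneg_right hBpart hX0) (mul_le_mul_of_nonneg_right hApart hA0)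
        _ ≤ _ := le_add_of_nonneg_right hcross
    have := Real.sqrt_le_sqrt hfin
    rwa [Real.sqrt_sq (hlam j), Real.sqrt_sq (hR0 j)] at this

/-! ## §3 ★★★ The coupled tower closed: `n` and `λ` in two slots -/

/-- ★★★ **THE COUPLED COMB TOWER CLOSED** (✓`Prop7CornerCombCoupledClosure.n_closure` ∘ `lam_closure`).  Under the hypotheses of both — the sourced mass recursion
`n_{j+1} ≤ (ρ + κ′_j)n_j + σ_j(m_j + n_j + λ_j)`, `n_0 = 0`, the gauge row of `lam_closure`, the windows `κ′ σ wM`, the sourceless lines `m g`, the two smallnesses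
`exp(θ′ρ³∕(1−ρ⁴))·θ₂·(1 + cB1)·ρ³∕(1−ρ⁴) ≤ ½` and `12wSθ₂²·ρ∕(1−ρ) ≤ ½`, and constants `cB0 cB1 cA` as in `lam_closure` — for every `j ≤ k₀`:
`n_j ≤ Qn·(ρ⁻¹)^j` and `λ_j ≤ (cB0 + cB1·Qn)·(ρ⁻¹)^j + cA·ρ^j`, `Qn = 2exp(θ′ρ³∕(1−ρ⁴))·θ₂·((M + cA)·ρ^{2k₀+1}∕(1−ρ²) + cB0·ρ³∕(1−ρ⁴))`.
[Balaban1987RG1 (0.1)∕(0.4) pp.251–253, scalar form of the inductive level bounds] -/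
theorem n_lam_closure {ρ θ' θ₂ ΘM wG wN wS Ĝ M cA cB0 cB1 : ℝ} (hρ0 : 0 < ρ) (hρ1 : ρ < 1) (hθ' : 0 ≤ θ') (hθ₂ : 0 ≤ θ₂) (hΘM : 0 ≤ ΘM)
    (hwG : 0 ≤ wG) (hwN : 0 ≤ wN) (hwS : 0 ≤ wS) (hM : 0 ≤ M) (hcA : 0 ≤ cA) (hcB0 : 0 ≤ cB0) (hcB1 : 0 ≤ cB1)
    (κ' σ n m g lam wM : ℕ → ℝ) (hκ' : ∀ j, 0 ≤ κ' j) (hσ : ∀ j, 0 ≤ σ j) (hn : ∀ j, 0 ≤ n j) (hm0 : ∀ j, 0 ≤ m j) (hg0 : ∀ j, 0 ≤ g j)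
    (hlam : ∀ j, 0 ≤ lam j) (hwM0 : ∀ j, 0 ≤ wM j) {k₀ : ℕ}
    (hκ'geo : ∀ j < k₀, κ' j ≤ θ' * ρ ^ (4 * (k₀ - j))) (hσgeo : ∀ j < k₀, σ j ≤ θ₂ * ρ ^ (2 * (k₀ - j)))
    (hwMgeo : ∀ j < k₀, wM j ≤ ΘM * ρ ^ (4 * (k₀ - j)))
    (hm : ∀ j ≤ k₀, m j ≤ M * ρ ^ j) (hg : ∀ j ≤ k₀, g j ≤ Ĝ * (ρ⁻¹) ^ j) (hn0 : n 0 = 0)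
    (hrec : ∀ j < k₀, n (j + 1) ≤ (ρ + κ' j) * n j + σ j * (m j + n j + lam j))
    (hrow : ∀ j ≤ k₀, lam j ^ 2 ≤ ∑ i ∈ Finset.range j,
      (ρ⁻¹) ^ (j - i) * (wG * g i ^ 2 + wN * n i ^ 2 + wM i * (m i ^ 2 + n i ^ 2) + wS * σ i ^ 2 * (m i + n i + lam i) ^ 2))
    (hsmall : Real.exp (θ' * (ρ ^ 3 / (1 - ρ ^ 4))) * θ₂ * (1 + cB1) * (ρ ^ 3 / (1 - ρ ^ 4)) ≤ 1 / 2)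
    (hsmallS : 12 * wS * θ₂ ^ 2 * (ρ / (1 - ρ)) ≤ 1 / 2)
    (hcB0sq : 2 * wG * Ĝ ^ 2 * (ρ / (1 - ρ)) ≤ cB0 ^ 2)
    (hcB1sq : 2 * (wN * (ρ / (1 - ρ)) + (ΘM + 3 * wS * θ₂ ^ 2) * (ρ ^ 5 / (1 - ρ ^ 5))) ≤ cB1 ^ 2)
    (hcAsq : 2 * ((ΘM + 3 * wS * θ₂ ^ 2) * M ^ 2) * (ρ / (1 - ρ)) ≤ cA ^ 2) :
    ∀ j ≤ k₀, n j ≤ (2 * Real.exp (θ' * (ρ ^ 3 / (1 - ρ ^ 4))) * θ₂ * ((M + cA) * (ρ ^ (2 * k₀ + 1) / (1 - ρ ^ 2)) + cB0 * (ρ ^ 3 / (1 - ρ ^ 4))))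
        * (ρ⁻¹) ^ j
      ∧ lam j ≤ (cB0 + cB1 * ((2 * Real.exp (θ' * (ρ ^ 3 / (1 - ρ ^ 4))) * θ₂
          * ((M + cA) * (ρ ^ (2 * k₀ + 1) / (1 - ρ ^ 2)) + cB0 * (ρ ^ 3 / (1 - ρ ^ 4)))))) * (ρ⁻¹) ^ j + cA * ρ ^ j := by
  have hfb := lam_closure hρ0 hρ1 hΘM hwG hwN hwS hcA hcB0 hcB1 σ n m g lam wM hσ hn hm0 hg0 hlam hwM0 hσgeo hwMgeo hm hg hrow hsmallS hcB0sq
    hcB1sq hcAsq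
  have hnb := n_closure hρ0 hρ1 hθ' hθ₂ hM hcA hcB0 hcB1 κ' σ n m lam hκ' hσ hn hm0 hlam hκ'geo hσgeo hm hn0 hrec hfb hsmall
  have hρ2 : ρ ^ 2 < 1 := pow_lt_one₀ hρ0.le hρ1 (by norm_num)
  have hρ4 : ρ ^ 4 < 1 := pow_lt_one₀ hρ0.le hρ1 (by norm_num)
  have hQ0 : 0 ≤ 2 * Real.exp (θ' * (ρ ^ 3 / (1 - ρ ^ 4))) * θ₂ * ((M + cA) * (ρ ^ (2 * k₀ + 1) / (1 - ρ ^ 2)) + cB0 * (ρ ^ 3 / (1 - ρ ^ 4))) := by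
    have h12 : 0 < 1 - ρ ^ 2 := by linarith
    have h14 : 0 < 1 - ρ ^ 4 := by linarith
    positivity
  intro j hj
  exact ⟨hnb j hj, hfb _ hQ0 j hj fun i hi => hnb i (by omega)⟩

/-- `ρ^{2k₀+1}·(ρ⁻¹)^j ≤ ρ·ρ^j` for `j ≤ k₀`, `0 < ρ < 1`: the top-anchored mass feed read at level `j` is A-shaped. [folklore] -/
theorem top_feed_le_A {ρ : ℝ} (hρ0 : 0 < ρ) (hρ1 : ρ < 1) {j k₀ : ℕ} (hj : j ≤ k₀) : ρ ^ (2 * k₀ + 1) * (ρ⁻¹) ^ j ≤ ρ * ρ ^ j := by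
  obtain ⟨s, rfl⟩ := Nat.exists_eq_add_of_le hj
  have h : ρ ^ (2 * (j + s) + 1) * (ρ⁻¹) ^ j = ρ * ρ ^ j * ρ ^ (2 * s) := by
    rw [inv_pow]; field_simp; ring
  rw [h]
  exact mul_le_of_le_one_right (by positivity) (pow_le_one₀ hρ0.le hρ1.le)

/-- ★★★ **THE TWO-SLOT OUTPUT.**  From the conclusion of `n_lam_closure` (taken as the hypothesis `h`), with `e = exp(θ′ρ³∕(1−ρ⁴))`, `aN = 2eθ₂(M + cA)·(ρ∕(1−ρ²))`, `bN = 2eθ₂·cB0·(ρ³∕(1−ρ⁴))`, for every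
`j ≤ k₀`: `n_j ≤ aN·ρ^j + bN·(ρ⁻¹)^j` and `λ_j ≤ (cA + cB1·aN)·ρ^j + (cB0 + cB1·bN)·(ρ⁻¹)^j` — the mass datum `M` only in the A-slot (times the source window `θ₂`), the gradient
datum `cB0` in the B-slot.  With `(ρ^j)² = L^{−j}`, `((ρ⁻¹)^j)² = Lʲ` and `sq_le_two_slot` this is the shape `A′·MASS₀·L^{−l} + B′·GRAD₀·Lˡ` of F-8b's cell theorem.
[Balaban1987RG1 (0.1)∕(0.4) pp.251–253] -/
theorem n_lam_two_slot {ρ θ' θ₂ M cA cB0 cB1 : ℝ} (hρ0 : 0 < ρ) (hρ1 : ρ < 1) (hθ₂ : 0 ≤ θ₂) (hM : 0 ≤ M) (hcA : 0 ≤ cA) (hcB1 : 0 ≤ cB1)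
    (n lam : ℕ → ℝ) {k₀ : ℕ}
    (h : ∀ j ≤ k₀, n j ≤ (2 * Real.exp (θ' * (ρ ^ 3 / (1 - ρ ^ 4))) * θ₂ * ((M + cA) * (ρ ^ (2 * k₀ + 1) / (1 - ρ ^ 2)) + cB0 * (ρ ^ 3 / (1 - ρ ^ 4))))
        * (ρ⁻¹) ^ j
      ∧ lam j ≤ (cB0 + cB1 * ((2 * Real.exp (θ' * (ρ ^ 3 / (1 - ρ ^ 4))) * θ₂
          * ((M + cA) * (ρ ^ (2 * k₀ + 1) / (1 - ρ ^ 2)) + cB0 * (ρ ^ 3 / (1 - ρ ^ 4)))))) * (ρ⁻¹) ^ j + cA * ρ ^ j) :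
    ∀ j ≤ k₀,
      n j ≤ (2 * Real.exp (θ' * (ρ ^ 3 / (1 - ρ ^ 4))) * θ₂ * (M + cA) * (ρ / (1 - ρ ^ 2))) * ρ ^ j
          + (2 * Real.exp (θ' * (ρ ^ 3 / (1 - ρ ^ 4))) * θ₂ * cB0 * (ρ ^ 3 / (1 - ρ ^ 4))) * (ρ⁻¹) ^ j
      ∧ lam j ≤ (cA + cB1 * (2 * Real.exp (θ' * (ρ ^ 3 / (1 - ρ ^ 4))) * θ₂ * (M + cA) * (ρ / (1 - ρ ^ 2)))) * ρ ^ j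
          + (cB0 + cB1 * (2 * Real.exp (θ' * (ρ ^ 3 / (1 - ρ ^ 4))) * θ₂ * cB0 * (ρ ^ 3 / (1 - ρ ^ 4)))) * (ρ⁻¹) ^ j := by
  intro j hj
  obtain ⟨hnj, hlj⟩ := h j hj
  have hρ2 : ρ ^ 2 < 1 := pow_lt_one₀ hρ0.le hρ1 (by norm_num)
  have h12 : 0 < 1 - ρ ^ 2 := by linarith
  have hρ4 : ρ ^ 4 < 1 := pow_lt_one₀ hρ0.le hρ1 (by norm_num)
  have h14 : 0 < 1 - ρ ^ 4 := by linarith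
  set e : ℝ := Real.exp (θ' * (ρ ^ 3 / (1 - ρ ^ 4))) with he
  have he0 : 0 ≤ e := (Real.exp_pos _).le
  have htop := top_feed_le_A hρ0 hρ1 hj
  have hsplit : (2 * e * θ₂ * ((M + cA) * (ρ ^ (2 * k₀ + 1) / (1 - ρ ^ 2)) + cB0 * (ρ ^ 3 / (1 - ρ ^ 4)))) * (ρ⁻¹) ^ j
      ≤ (2 * e * θ₂ * (M + cA) * (ρ / (1 - ρ ^ 2))) * ρ ^ j + (2 * e * θ₂ * cB0 * (ρ ^ 3 / (1 - ρ ^ 4))) * (ρ⁻¹) ^ j := by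
    have hc0 : 0 ≤ 2 * e * θ₂ * (M + cA) / (1 - ρ ^ 2) := by positivity
    have := mul_le_mul_of_nonneg_left htop hc0
    have e1 : (2 * e * θ₂ * ((M + cA) * (ρ ^ (2 * k₀ + 1) / (1 - ρ ^ 2)) + cB0 * (ρ ^ 3 / (1 - ρ ^ 4)))) * (ρ⁻¹) ^ j
        = 2 * e * θ₂ * (M + cA) / (1 - ρ ^ 2) * (ρ ^ (2 * k₀ + 1) * (ρ⁻¹) ^ j) + (2 * e * θ₂ * cB0 * (ρ ^ 3 / (1 - ρ ^ 4))) * (ρ⁻¹) ^ j := by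
      ring
    have e2 : (2 * e * θ₂ * (M + cA) * (ρ / (1 - ρ ^ 2))) * ρ ^ j = 2 * e * θ₂ * (M + cA) / (1 - ρ ^ 2) * (ρ * ρ ^ j) := by
      ring
    rw [e1, e2]
    linarith
  refine ⟨hnj.trans hsplit, hlj.trans ?_⟩
  have hcB1' := mul_le_mul_of_nonneg_left hsplit hcB1
  have e3 : (cB0 + cB1 * (2 * e * θ₂ * ((M + cA) * (ρ ^ (2 * k₀ + 1) / (1 - ρ ^ 2)) + cB0 * (ρ ^ 3 / (1 - ρ ^ 4))))) * (ρ⁻¹) ^ j + cA * ρ ^ j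
      = cB0 * (ρ⁻¹) ^ j + cA * ρ ^ j
        + cB1 * ((2 * e * θ₂ * ((M + cA) * (ρ ^ (2 * k₀ + 1) / (1 - ρ ^ 2)) + cB0 * (ρ ^ 3 / (1 - ρ ^ 4)))) * (ρ⁻¹) ^ j) := by ring
  have e4 : (cA + cB1 * (2 * e * θ₂ * (M + cA) * (ρ / (1 - ρ ^ 2)))) * ρ ^ j + (cB0 + cB1 * (2 * e * θ₂ * cB0 * (ρ ^ 3 / (1 - ρ ^ 4)))) * (ρ⁻¹) ^ j
      = cB0 * (ρ⁻¹) ^ j + cA * ρ ^ j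
        + cB1 * ((2 * e * θ₂ * (M + cA) * (ρ / (1 - ρ ^ 2))) * ρ ^ j + (2 * e * θ₂ * cB0 * (ρ ^ 3 / (1 - ρ ^ 4))) * (ρ⁻¹) ^ j) := by ring
  rw [e3, e4]
  linarith

end Summit.QuantumFields.YangMills.Theorems.Prop7CornerCombLambdaClosure

end
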